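import Summits.RiemannHypothesis.RiemannHypothesis.Theorems.Splittings.RobinFiniteStairKey
import Literature.NumberTheory.LFunctions.RobinCABelow
import HarnessLib

/-!
# RobinFiniteStairLaw — g18 «THE WHOLE STAIRCASE», part 6/9

`mertens_prod_lt_of3` (Mertens assembly with storey sum `Y = θQ + Λ`), `mertensProdLt_stair_of` (one level; generic base `β`, window top
free, the `θ`-window a hypothesis), `thetaWindow_of_top` (the window from Büthe 2016 + RH(T) under the cap `β_k + d_k ≤ 0.0463 + (1 + 2/L1
k)/2`), THE GENERIC LAW `robinCA_below_stair_of` (any budget table `β` carrying the shifted key inequality, tolerance table `tol`, window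
hypothesis), `level3_of_tolSt`, and its instance `robinCA_below_stair` (`β = b_k`): {Büthe 2016 Thm 2, Büthe 2018 Thm 2, BKLNW 2021} +
`RiemannHypothesisUpTo T` (`T ≥ 10⁵`) + the level conditions ⟹ `robinCA_below (X+1)` (`X < 4¹⁸`).

Cell rh-split, seat rh-split-robin-finite g18 (brief sha16 f79c5f09d8bcb036), card `cards/SPLIT-robin-finite.md` §25; carved VERBATIM from the
kernel-checked object `HOME/rh-split-robin-finite/g18/SketchG18.lean` (sha16 71a1ab953989b3a4; `lean check` rc 0, 0 warnings, 0 sorries).  Zero `instance`,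
zero `notation`, no attribute changes, no `native_decide` in this file; no `def … : Prop`; every conjecture / print fact appears only as an explicit
hypothesis (`Buthe2016_thm2`, `Buthe2018_thm2_theta`, `BroadbentEtAl2021_theta_rel_1e19`, `RiemannHypothesisUpTo T`).

THE LINE.  A colossally abundant `N = ∏ p^{a_p}` with largest prime `P` and structure prime `Q` (largest prime of exponent `≥ 2`) satisfies not
only `log N ≥ θ(P) + θ(Q)` (the tree) but `log N ≥ θ(P) + θ(Q) + Λ` with `Λ = Σ_{j≥3} θ(x_j)` the higher storeys of the Alaoglu–Erdős staircase;
`Λ_K` is certified per dyadic piece `2^K ≤ P < 2^{K+1}` and spent on the analytic side as EXTRA zero-tail budget `d_k` on top of the tree's level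
budgets `b_k` (`E_b` is affine in `b`; the gain `G₁^Λ − G₁` pays `d_k·w(P)`), so the SAME verified height `T` certifies a LONGER range of CA primes; the shift is
generic in its base (`key_ineq_shift`, part 5) and composes with the tree's `√`-window budgets `b'_k` (composition add-on, 2 files).

HONEST LABEL: «SPLITTING SEARCH over kernel-typed RH-EQUIVALENCES; a splitting A ∧ B ⟹ RH is CONDITIONAL bookkeeping unless A and B
are both proved; nothing here bears on the truth of RH.»
-/

set_option linter.dupNamespace false

noncomputable section

open Real Finset
open scoped ArithmeticFunction.sigma Chebyshev

namespace Summit.RiemannHypothesis.RiemannHypothesis.Theorems.Splittings.RobinFiniteC1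

section StaircaseLaw

open Literature.NumberTheory.LFunctions Literature.NumberTheory.DiophantineGeometry
open RobinAnalyticSharp RobinAnalyticSharp.Cells
open Summit.RiemannHypothesis.RiemannHypothesis.Theorems.Splittings.RobinFiniteE3
open Summit.RiemannHypothesis.RiemannHypothesis.Theorems.Splittings.RobinFiniteTail

/-- **C4 · main estimate with a general second storey `Y ≥ 0`** (tree `mertens_prod_lt_of` verbatim with `θ Q ↦ Y`):
`−log f(P) ≤ E`, `E < G₂ + Y/((θP + Y) log(θP + Y))` ⟹ `(∏_{p≤P}(1−1/p))⁻¹·∏_{Q<p≤P}(1−1/p²) < e^γ log(θP + Y)`. -/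
theorem mertens_prod_lt_of3 {B : ℝ} (hW : (∀ y : ℝ, 599 ≤ y → y ≤ B → |θ y - y| ≤ √y * Real.log y ^ 2 / (8 * π)))
    {P Q : ℕ} {E Y : ℝ} (hP : 4 ^ 11 ≤ P) (hPB : (P : ℝ) ≤ B) (hY : 0 ≤ Y) (hfE : -Real.log (nicolasF P) ≤ E)
    (h3 : E < ∑ p ∈ (Nat.primesLE P).filter (fun p => Q < p), ((p : ℝ) ^ 2)⁻¹ + Y / ((θ P + Y) * Real.log (θ P + Y))) :
    (∏ p ∈ Nat.primesLE P, (1 - (p : ℝ)⁻¹))⁻¹ *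
        ∏ p ∈ (Nat.primesLE P).filter (fun p => Q < p), (1 - ((p : ℝ) ^ 2)⁻¹) <
      rexp eulerMascheroniConstant * Real.log (θ P + Y) := by
  have hPr : (4 : ℝ) ^ 11 ≤ P := by exact_mod_cast hP
  have hP599 : (599 : ℝ) ≤ P := le_trans (by norm_num) hPr
  obtain ⟨hθPl, -⟩ := theta_two_sidedW hW hP599 le_rfl hPB
  have hδP := schoenfeldDelta_le hP599
  have hθP1 : 1 < θ P := by
    have : (1 - 0.0666) * 599 ≤ (1 - schoenfeldDelta P) * (P : ℝ) :=
      mul_le_mul (by linarith) hP599 (by norm_num) (by linarith [schoenfeldDelta_nonneg (P : ℝ)])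
    linarith
  set S := ∑ p ∈ (Nat.primesLE P).filter (fun p => Q < p), ((p : ℝ) ^ 2)⁻¹ with hSdef
  set R := θ P + Y with hR
  set A := Real.log (θ P) with hA
  have hA0 : 0 < A := Real.log_pos hθP1
  have hR1 : 1 < R := by linarith
  have hlogR0 : 0 < Real.log R := Real.log_pos hR1
  have h1 : (∏ p ∈ Nat.primesLE P, (1 - (p : ℝ)⁻¹))⁻¹ ≤ rexp eulerMascheroniConstant * A * rexp E := by
    have h := prod_le_of_neg_log_le (x := (P : ℝ)) hP599 hfE
    rwa [Nat.floor_natCast] at h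
  have h2 : ∏ p ∈ (Nat.primesLE P).filter (fun p => Q < p), (1 - ((p : ℝ) ^ 2)⁻¹) ≤ rexp (-S) := by
    refine RobinAnalytic.prod_one_sub_le_exp_neg_sum _ _ fun p hp => ?_
    have hp' := Nat.prime_of_mem_primesLE (Finset.mem_filter.1 hp).1
    have : (1 : ℝ) ≤ (p : ℝ) ^ 2 := by
      have : (1 : ℝ) ≤ p := by exact_mod_cast hp'.one_lt.le
      nlinarith
    exact inv_le_one_of_one_le₀ this
  have hPi0 : 0 ≤ ∏ p ∈ (Nat.primesLE P).filter (fun p => Q < p), (1 - ((p : ℝ) ^ 2)⁻¹) :=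
    Finset.prod_nonneg fun p hp => by
      have hp' := Nat.prime_of_mem_primesLE (Finset.mem_filter.1 hp).1
      have : (1 : ℝ) ≤ (p : ℝ) ^ 2 := by
        have : (1 : ℝ) ≤ p := by exact_mod_cast hp'.one_lt.le
        nlinarith
      linarith [inv_le_one_of_one_le₀ this]
  have h4 : Y / (R * Real.log R) ≤ Real.log (Real.log R) - Real.log A := by
    have hθPpos : 0 < θ P := by linarith
    have hRA : Real.log R - A = Real.log (R / θ P) := by
      rw [hA, Real.log_div (by linarith) hθPpos.ne']
    have h5 : Y / R ≤ Real.log R - A := by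
      rw [hRA]
      have := Real.one_sub_inv_le_log_of_pos (x := R / θ P) (by positivity)
      have e1 : 1 - (R / θ P)⁻¹ = Y / R := by
        rw [hR]; field_simp; ring
      linarith
    have h6 : (Real.log R - A) / Real.log R ≤ Real.log (Real.log R) - Real.log A := by
      rw [← Real.log_div hlogR0.ne' hA0.ne']
      have := Real.one_sub_inv_le_log_of_pos (x := Real.log R / A) (by positivity)
      have e1 : 1 - (Real.log R / A)⁻¹ = (Real.log R - A) / Real.log R := by field_simp
      linarith
    calc Y / (R * Real.log R) = Y / R / Real.log R := by rw [div_div]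
      _ ≤ (Real.log R - A) / Real.log R := div_le_div_of_nonneg_right h5 hlogR0.le
      _ ≤ Real.log (Real.log R) - Real.log A := h6
  have h7 : A * rexp (E - S) < Real.log R := by
    have h8 : E - S < Real.log (Real.log R) - Real.log A := by linarith [h3, h4]
    have h9 : rexp (E - S) < Real.log R / A := by
      calc rexp (E - S) < rexp (Real.log (Real.log R) - Real.log A) := Real.exp_lt_exp.2 h8
        _ = Real.log R / A := by rw [Real.exp_sub, Real.exp_log hlogR0, Real.exp_log hA0]
    have := mul_lt_mul_of_pos_left h9 hA0
    rwa [mul_div_cancel₀ _ hA0.ne'] at this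
  calc (∏ p ∈ Nat.primesLE P, (1 - (p : ℝ)⁻¹))⁻¹ *
        ∏ p ∈ (Nat.primesLE P).filter (fun p => Q < p), (1 - ((p : ℝ) ^ 2)⁻¹)
      ≤ (rexp eulerMascheroniConstant * A * rexp E) * rexp (-S) := by
        calc _ ≤ (rexp eulerMascheroniConstant * A * rexp E) *
              ∏ p ∈ (Nat.primesLE P).filter (fun p => Q < p), (1 - ((p : ℝ) ^ 2)⁻¹) :=
              mul_le_mul_of_nonneg_right h1 hPi0
          _ ≤ (rexp eulerMascheroniConstant * A * rexp E) * rexp (-S) :=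
              mul_le_mul_of_nonneg_left h2 (by positivity)
    _ = rexp eulerMascheroniConstant * (A * rexp (E - S)) := by
        rw [Real.exp_sub, Real.exp_neg]; ring
    _ < rexp eulerMascheroniConstant * Real.log R := mul_lt_mul_of_pos_left h7 (Real.exp_pos _)

/-- `b_k + d_k ≤ 0.52`. -/
theorem bk_add_dk_le {k : ℕ} (hk11 : 11 ≤ k) (hk17 : k ≤ 17) : ((bk k : ℚ) : ℝ) + ((dk k : ℚ) : ℝ) ≤ 0.52 := by
  interval_cases k <;> norm_num [bk, dk]

/-- The budget cap the law needs (so the level condition still forces Büthe's range `tailH·√X ≤ 1`): `b_k + d_k ≤ 0.0463 + (1 + 2/L1 k)/2`. -/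
theorem bk_cap {k : ℕ} (hk11 : 11 ≤ k) (hk17 : k ≤ 17) :
    ((bk k : ℚ) : ℝ) + ((dk k : ℚ) : ℝ) ≤ 0.0463 + (1 + 2 / ((L1 k : ℚ) : ℝ)) / 2 := by
  have h := bk_add_dk_le hk11 hk17
  have hL₁8 := (range_facts (k := k) (by omega)).2.2.2.2.1
  have : (0 : ℝ) ≤ 2 / ((L1 k : ℚ) : ℝ) := div_nonneg (by norm_num) (by linarith)
  linarith

/-- `a + a⁻¹ ≤ b + b⁻¹` for `1 ≤ a ≤ b` (`u ↦ u + 1/u` is increasing on `[1, ∞)`; private copy of the tree's private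
`RobinFiniteReflLow.add_inv_le_add_inv`, which is not nameable from here). -/
private theorem add_inv_le_add_inv' {a b : ℝ} (ha : 1 ≤ a) (hab : a ≤ b) : a + a⁻¹ ≤ b + b⁻¹ := by
  have ha0 : 0 < a := by linarith
  have hb0 : 0 < b := by linarith
  have hab1 : 1 ≤ a * b := by nlinarith
  have key : b + b⁻¹ - (a + a⁻¹) = (b - a) * (a * b - 1) / (a * b) := by
    field_simp
    ring
  have : 0 ≤ (b - a) * (a * b - 1) / (a * b) :=
    div_nonneg (mul_nonneg (by linarith) (by linarith)) (by positivity)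
  linarith

/-- **C5 · one level of the shifted law, generic base and window** (tree `mertensProdLt_level_refl` with the window top `X ≥ P`
FREE, so a partial top level is allowed): RH verified to `T ≥ 10⁵`, the reflection-paired zero tail on `[4ᵏ, X]`, a `θ`-window
`|θ(y) − y| ≤ √y log²y/(8π)` on `[599, X]` (hypothesis `hW`: from Büthe 2016 + RH(T) via `thetaWindow_of_top`, or unconditionally
from Büthe 2018 via the tree's `thetaWindow_ofB`), and the shifted key inequality at every `b' ≤ β + d_k` (hypothesis `hkey`, e.g.
`key_ineq_level3` with `β = b_k` or `key_ineq_level3S` with `β = b'_k`) give the CA Mertens inequality with the storey sum `θQ + Λ`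
for `4ᵏ ≤ P ≤ X`, under the raised level condition `0.0463 + (1 + 2/L1 k)·tailH(T)·(√X + 1/√X)/2 ≤ β + d_k`. -/
theorem mertensProdLt_stair_of (hB : Buthe2018_thm2_theta)
    (hK : BroadbentEtAl2021_theta_rel_1e19) {T : ℝ} (hT : 100000 ≤ T) (hRH : RiemannHypothesisUpTo T)
    {k : ℕ} (hk11 : 11 ≤ k) (hk17 : k ≤ 17) {X : ℝ} {P Q : ℕ} (hPl : 4 ^ k ≤ P) (hPX : (P : ℝ) ≤ X) {β : ℝ}
    (hW : ∀ y : ℝ, 599 ≤ y → y ≤ X → |θ y - y| ≤ √y * Real.log y ^ 2 / (8 * π))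
    (hkey : ∀ b' : ℝ, b' ≤ β + ((dk k : ℚ) : ℝ) →
      (nicolasERH P + (b' - nicolasBeta) *
          (1 / (√P * Real.log P) + 1 / (√P * Real.log P ^ 2) + 4 / (√P * Real.log P ^ 3))) <
        ∑ p ∈ (Nat.primesLE P).filter (fun p => Q < p), ((p : ℝ) ^ 2)⁻¹ +
          (θ Q + ((lamQ (pieceK k P) : ℚ) : ℝ)) /
          ((θ P + (θ Q + ((lamQ (pieceK k P) : ℚ) : ℝ))) * Real.log (θ P + (θ Q + ((lamQ (pieceK k P) : ℚ) : ℝ)))))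
    (hlev : 0.0463 + (1 + 2 / ((L1 k : ℚ) : ℝ)) *
      (((Real.log (T / (2 * π)) + 1) / (π * T) + (184 + 30 * Real.log T) / T ^ 2) * ((√X + (√X)⁻¹) / 2)) ≤
        β + ((dk k : ℚ) : ℝ)) :
    (∏ p ∈ Nat.primesLE P, (1 - (p : ℝ)⁻¹))⁻¹ *
        ∏ p ∈ (Nat.primesLE P).filter (fun p => Q < p), (1 - ((p : ℝ) ^ 2)⁻¹) <
      rexp eulerMascheroniConstant * Real.log (θ P + (θ Q + ((lamQ (pieceK k P) : ℚ) : ℝ))) := by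
  have hT7 : (7 : ℝ) ≤ T := by linarith
  have ht0 := tailH_nonneg hT7
  obtain ⟨hP₁599, hL₁, -, -, hL₁8, -, -⟩ := range_facts (k := k) (by omega)
  obtain ⟨-, -, -, -, -, -, hΛ₁0, hΛ₂0, -⟩ := level_consts hk11 hk17
  have hPr : (4 : ℝ) ^ k ≤ P := by exact_mod_cast hPl
  have hP599 : (599 : ℝ) ≤ P := hP₁599.trans hPr
  have hP11 : 4 ^ 11 ≤ P := le_trans (Nat.pow_le_pow_right (by norm_num) hk11) hPl
  have hP11r : (4 : ℝ) ^ 11 ≤ P := by exact_mod_cast hP11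
  have hX11 : (4 : ℝ) ^ 11 ≤ X := hP11r.trans hPX
  have hX1 : (1 : ℝ) ≤ X := le_trans (by norm_num) hX11
  have hL₁0 : (0 : ℝ) < ((L1 k : ℚ) : ℝ) := by linarith
  have hfac0 : (0 : ℝ) ≤ 2 / ((L1 k : ℚ) : ℝ) := by positivity
  set t : ℝ := ((Real.log (T / (2 * π)) + 1) / (π * T) + (184 + 30 * Real.log T) / T ^ 2) with ht_def
  set u : ℝ := √X with hu_def
  have hu1 : (1 : ℝ) ≤ u := by rw [hu_def, ← Real.sqrt_one]; exact Real.sqrt_le_sqrt hX1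
  have hu0 : 0 < u := by positivity
  have hlow := negLog_le_Eb_point_refl hB hK hT7 hRH hW hP599 hPX
  have hlogP : ((L1 k : ℚ) : ℝ) ≤ Real.log P := hL₁.trans (Real.log_le_log (by positivity) hPr)
  have h2 : 2 / Real.log (P : ℝ) ≤ 2 / ((L1 k : ℚ) : ℝ) := div_le_div_of_nonneg_left (by norm_num) hL₁0 hlogP
  have h2' : (0 : ℝ) ≤ 2 / Real.log (P : ℝ) := div_nonneg (by norm_num) (hL₁0.le.trans hlogP)
  have hsP1 : 1 ≤ √(P : ℝ) := by rw [← Real.sqrt_one]; exact Real.sqrt_le_sqrt (by linarith)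
  have hsP : √(P : ℝ) ≤ u := Real.sqrt_le_sqrt hPX
  have hch : (√(P : ℝ) + (√(P : ℝ))⁻¹) / 2 ≤ (u + u⁻¹) / 2 := by
    have := add_inv_le_add_inv' hsP1 hsP; linarith
  have hch0 : 0 ≤ (√(P : ℝ) + (√(P : ℝ))⁻¹) / 2 := by positivity
  have h3 : t * ((√(P : ℝ) + (√(P : ℝ))⁻¹) / 2) ≤ t * ((u + u⁻¹) / 2) := mul_le_mul_of_nonneg_left hch ht0
  have h4 : (1 + 2 / Real.log (P : ℝ)) * (t * ((√(P : ℝ) + (√(P : ℝ))⁻¹) / 2)) ≤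
      (1 + 2 / ((L1 k : ℚ) : ℝ)) * (t * ((u + u⁻¹) / 2)) :=
    mul_le_mul (by linarith) h3 (mul_nonneg ht0 hch0) (by linarith)
  have hbud : 0.0463 + (1 + 2 / Real.log (P : ℝ)) * (t * ((√(P : ℝ) + (√(P : ℝ))⁻¹) / 2)) ≤ β + ((dk k : ℚ) : ℝ) := by
    linarith
  have hkey' := hkey _ hbud
  have hY : 0 ≤ θ (Q : ℝ) + ((lamQ (pieceK k P) : ℚ) : ℝ) := by
    have := Chebyshev.theta_nonneg (Q : ℝ)
    unfold pieceK; split_ifs <;> linarith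
  exact mertens_prod_lt_of3 hW hP11 hPX hY hlow hkey'

/-- The raised level condition from the tolerance table `tolSt` (full levels: `√X = 2ᵏ⁺¹`). -/
theorem level3_of_tolSt {t : ℝ} {k : ℕ} (hk11 : 11 ≤ k) (hk17 : k ≤ 17) (ht : t ≤ ((tolSt k : ℚ) : ℝ)) :
    0.0463 + (1 + 2 / ((L1 k : ℚ) : ℝ)) * (t * (((2 : ℝ) ^ (k + 1) + ((2 : ℝ) ^ (k + 1))⁻¹) / 2)) ≤
      ((bk k : ℚ) : ℝ) + ((dk k : ℚ) : ℝ) := by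
  interval_cases k <;>
    · simp only [tolSt, bk, dk, L1, l2] at ht ⊢; push_cast at ht ⊢; norm_num at ht ⊢; nlinarith [ht]

/-- **Büthe's range from the top level.**  If the budget table is capped by `β_k + d_k ≤ 0.0463 + (1 + 2/L1 k)/2` and the
top level `4ᵏ ≤ X < 4ᵏ⁺¹` passes its condition, then `tailH(T)·√X ≤ 1`, hence `4.92·√(X/log X) ≤ T`, and Büthe 2016 Thm 2 +
`RH(T)` give the `θ`-window `|θ(y) − y| ≤ √y log²y/(8π)` on `[599, X]` (tree `thetaWindow_low`; the kernel table below `8 886 113`). -/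
theorem thetaWindow_of_top (h16 : Buthe2016_thm2) {T : ℝ} (hT : 100000 ≤ T) (hRH : RiemannHypothesisUpTo T) {β : ℕ → ℚ}
    (hcap : ∀ k : ℕ, 11 ≤ k → k ≤ 17 → ((β k : ℚ) : ℝ) + ((dk k : ℚ) : ℝ) ≤ 0.0463 + (1 + 2 / ((L1 k : ℚ) : ℝ)) / 2)
    {X : ℕ} (hX18 : (X : ℝ) < (4 : ℝ) ^ 18)
    (htop : ∀ k : ℕ, 11 ≤ k → k ≤ 17 → (4 : ℝ) ^ k ≤ (X : ℝ) → (X : ℝ) < (4 : ℝ) ^ (k + 1) →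
      0.0463 + (1 + 2 / ((L1 k : ℚ) : ℝ)) *
        (((Real.log (T / (2 * π)) + 1) / (π * T) + (184 + 30 * Real.log T) / T ^ 2) * ((√(X : ℝ) + (√(X : ℝ))⁻¹) / 2)) ≤
        ((β k : ℚ) : ℝ) + ((dk k : ℚ) : ℝ))
    (hX11 : (4 : ℝ) ^ 11 ≤ (X : ℝ)) :
    ∀ y : ℝ, 599 ≤ y → y ≤ (X : ℝ) → |θ y - y| ≤ √y * Real.log y ^ 2 / (8 * π) := by
  have hT0 : 0 < T := by linarith
  have hT7 : (7 : ℝ) ≤ T := by linarith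
  have ht0 := tailH_nonneg hT7
  have hX0 : X ≠ 0 := by rintro rfl; norm_num at hX11
  have hkl : 4 ^ Nat.log 4 X ≤ X := Nat.pow_log_le_self 4 hX0
  have hku : X < 4 ^ (Nat.log 4 X + 1) := Nat.lt_pow_succ_log_self (by norm_num) X
  have hk11 : 11 ≤ Nat.log 4 X := by
    by_contra h; push Not at h
    have h1 : 4 ^ (Nat.log 4 X + 1) ≤ 4 ^ 11 := Nat.pow_le_pow_right (by norm_num) (by omega)
    have : (X : ℝ) < (4 : ℝ) ^ 11 := by exact_mod_cast lt_of_lt_of_le hku h1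
    linarith
  have hk17 : Nat.log 4 X ≤ 17 := by
    by_contra h; push Not at h
    have h1 : 4 ^ 18 ≤ 4 ^ Nat.log 4 X := Nat.pow_le_pow_right (by norm_num) (by omega)
    have : (4 : ℝ) ^ 18 ≤ X := by exact_mod_cast h1.trans hkl
    linarith
  have hlev := htop _ hk11 hk17 (by exact_mod_cast hkl) (by exact_mod_cast hku)
  have hc := hcap _ hk11 hk17
  have hL₁8 := (range_facts (k := Nat.log 4 X) (by omega)).2.2.2.2.1
  have hL₁0 : (0 : ℝ) < ((L1 (Nat.log 4 X) : ℚ) : ℝ) := by linarith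
  have hfac0 : (0 : ℝ) ≤ 2 / ((L1 (Nat.log 4 X) : ℚ) : ℝ) := by positivity
  have hfpos : (0 : ℝ) < 1 + 2 / ((L1 (Nat.log 4 X) : ℚ) : ℝ) := by linarith
  have hX1 : (1 : ℝ) ≤ X := le_trans (by norm_num) hX11
  set t : ℝ := ((Real.log (T / (2 * π)) + 1) / (π * T) + (184 + 30 * Real.log T) / T ^ 2) with ht_def
  set u : ℝ := √(X : ℝ) with hu_def
  have hu0 : 0 < u := by positivity
  have hinv : 0 ≤ u⁻¹ := by positivity
  have htu : t * u ≤ 1 := by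
    have h1 : (1 + 2 / ((L1 (Nat.log 4 X) : ℚ) : ℝ)) * (t * ((u + u⁻¹) / 2)) ≤
        (1 + 2 / ((L1 (Nat.log 4 X) : ℚ) : ℝ)) * (1 / 2) := by
      linarith
    have h2 : t * ((u + u⁻¹) / 2) ≤ 1 / 2 := le_of_mul_le_mul_left h1 hfpos
    have e : t * ((u + u⁻¹) / 2) = (t * u + t * u⁻¹) / 2 := by ring
    have h3 : 0 ≤ t * u⁻¹ := mul_nonneg ht0 hinv
    linarith
  have hrange : 4.92 * Real.sqrt (X / Real.log X) ≤ T :=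
    buthe_range_low_refl hT0 hX11 (le_of_tail_budget_refl hT hu0.le htu)
  exact thetaWindow_low h16 hT0 hRH hrange

open scoped ArithmeticFunction.sigma in
/-- **C6⁰ · THE LOW-HEIGHT CA-SIDE HEIGHT LAW WITH THE WHOLE STAIRCASE — generic budgets.**  For ANY level budget table `β`
that carries the shifted key inequality at `b' ≤ β_k + d_k` (hypothesis `hkey`: `key_ineq_level3` for the tree's `b_k`,
`key_ineq_level3S` for the `√`-window `b'_k`) and a tolerance table `tol` sound for the full levels (`htol`): RH verified to ANY
height `T ≥ 10⁵` + {Büthe 2018 Thm 2, BKLNW 2021} + a `θ`-window on `[599, X]` (hypothesis `hW`, used only when `X ≥ 4¹¹`: Büthe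
2016 + RH(T) via `thetaWindow_of_top`, or Büthe 2018 ALONE via the tree's `thetaWindow_ofB`) ⟹ Robin's
inequality at every colossally abundant `N > 5040` all of whose primes are `≤ X` (`X < 4¹⁸`), provided every FULL level
`4ᵏ⁺¹ ≤ X` has `tailH(T) ≤ tol k` and the TOP level `4ᵏ ≤ X < 4ᵏ⁺¹` passes `0.0463 + (1 + 2/L1 k)·tailH(T)·(√X + 1/√X)/2 ≤ β_k + d_k`
(primes `< 4¹¹` by the kernel theorem `robinCA_below_four_pow_eleven`; CA side: `log N ≥ θP + θQ + Λ_K`,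
`theta_add_theta_add_lam_le_log`, and `Q < 4√P + 4`, `structureQ_lt`).  No conjecture in hypothesis position. -/
theorem robinCA_below_stair_of {β tol : ℕ → ℚ}
    (hkey : ∀ {B : ℝ}, (∀ y : ℝ, 599 ≤ y → y ≤ B → |θ y - y| ≤ √y * Real.log y ^ 2 / (8 * π)) →
      ∀ {k : ℕ}, 11 ≤ k → k ≤ 17 → ∀ {P Q : ℕ}, 4 ^ k ≤ P → P ≤ 4 ^ (k + 1) → (P : ℝ) ≤ B → Q ≤ P →
      (Q : ℝ) < 4 * √(P : ℝ) + 4 → ∀ {b' : ℝ}, b' ≤ ((β k : ℚ) : ℝ) + ((dk k : ℚ) : ℝ) →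
      (nicolasERH P + (b' - nicolasBeta) *
          (1 / (√P * Real.log P) + 1 / (√P * Real.log P ^ 2) + 4 / (√P * Real.log P ^ 3))) <
        ∑ p ∈ (Nat.primesLE P).filter (fun p => Q < p), ((p : ℝ) ^ 2)⁻¹ +
          (θ Q + ((lamQ (pieceK k P) : ℚ) : ℝ)) /
          ((θ P + (θ Q + ((lamQ (pieceK k P) : ℚ) : ℝ))) * Real.log (θ P + (θ Q + ((lamQ (pieceK k P) : ℚ) : ℝ)))))
    (htol : ∀ (k : ℕ) (t : ℝ), 11 ≤ k → k ≤ 17 → t ≤ ((tol k : ℚ) : ℝ) →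
      0.0463 + (1 + 2 / ((L1 k : ℚ) : ℝ)) * (t * (((2 : ℝ) ^ (k + 1) + ((2 : ℝ) ^ (k + 1))⁻¹) / 2)) ≤
        ((β k : ℚ) : ℝ) + ((dk k : ℚ) : ℝ))
    (hB : Buthe2018_thm2_theta)
    (hK : BroadbentEtAl2021_theta_rel_1e19) {T : ℝ} (hT : 100000 ≤ T) (hRH : RiemannHypothesisUpTo T) {X : ℕ}
    (hX18 : (X : ℝ) < (4 : ℝ) ^ 18)
    (hW : (4 : ℝ) ^ 11 ≤ (X : ℝ) → ∀ y : ℝ, 599 ≤ y → y ≤ (X : ℝ) → |θ y - y| ≤ √y * Real.log y ^ 2 / (8 * π))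
    (hfull : ∀ k : ℕ, 11 ≤ k → k ≤ 17 → (4 : ℝ) ^ (k + 1) ≤ (X : ℝ) →
      ((Real.log (T / (2 * π)) + 1) / (π * T) + (184 + 30 * Real.log T) / T ^ 2) ≤ ((tol k : ℚ) : ℝ))
    (htop : ∀ k : ℕ, 11 ≤ k → k ≤ 17 → (4 : ℝ) ^ k ≤ (X : ℝ) → (X : ℝ) < (4 : ℝ) ^ (k + 1) →
      0.0463 + (1 + 2 / ((L1 k : ℚ) : ℝ)) *
        (((Real.log (T / (2 * π)) + 1) / (π * T) + (184 + 30 * Real.log T) / T ^ 2) * ((√(X : ℝ) + (√(X : ℝ))⁻¹) / 2)) ≤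
        ((β k : ℚ) : ℝ) + ((dk k : ℚ) : ℝ)) :
    robinCA_below (X + 1) := by
  intro N hCA h5040 hprimes
  have hN0 : N ≠ 0 := by omega
  obtain ⟨ε, P, Q, hε, hpar, hP, hPN, -, hQP, hpf, h2, -, hσ, -, -⟩ := hCA.exists_structure
  by_cases hsmall : P < 4 ^ 11
  · refine robinCA_below_four_pow_eleven N hCA h5040 fun p hp hpN => lt_of_le_of_lt ?_ hsmall
    have : p ∈ N.primeFactors := Nat.mem_primeFactors.2 ⟨hp, hpN, hN0⟩
    rw [hpf] at this
    exact (Nat.mem_primesLE.1 this).1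
  rw [not_lt] at hsmall
  have hPX : (P : ℝ) ≤ X := by
    have := hprimes P hP hPN
    exact_mod_cast Nat.lt_succ_iff.1 this
  have hWX := hW (le_trans (by exact_mod_cast hsmall) hPX)
  have hP0 : P ≠ 0 := hP.ne_zero
  -- the level `k = Nat.log 4 P ∈ [11, 17]`
  have hPl : 4 ^ Nat.log 4 P ≤ P := Nat.pow_log_le_self 4 hP0
  have hPu : P < 4 ^ (Nat.log 4 P + 1) := Nat.lt_pow_succ_log_self (by norm_num) P
  have hk11 : 11 ≤ Nat.log 4 P := by
    by_contra h; push Not at h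
    have : 4 ^ (Nat.log 4 P + 1) ≤ 4 ^ 11 := Nat.pow_le_pow_right (by norm_num) (by omega)
    omega
  have hP18 : (P : ℝ) < (4 : ℝ) ^ 18 := lt_of_le_of_lt hPX hX18
  have hk17 : Nat.log 4 P ≤ 17 := by
    by_contra h; push Not at h
    have h1 : 4 ^ 18 ≤ 4 ^ Nat.log 4 P := Nat.pow_le_pow_right (by norm_num) (by omega)
    have : (4 : ℝ) ^ 18 ≤ P := by exact_mod_cast h1.trans hPl
    linarith
  set k := Nat.log 4 P with hk_def
  have hQs := structureQ_lt hpar hN0 hP hpf h2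
  -- the staircase bound `θP + θQ + Λ ≤ log N`
  obtain ⟨h22, h35⟩ := pieceK_bounds (P := P) hk11 hk17
  have hθ3 := theta_add_theta_add_lam_le_log hpar hε hN0 hP hPN hpf hQP h2 (two_pow_pieceK_le hPl) h22 h35
  -- the CA Mertens inequality on the level of `P`
  have hkX : (4 : ℝ) ^ k ≤ X := le_trans (by exact_mod_cast hPl) hPX
  have hlt : (∏ p ∈ Nat.primesLE P, (1 - (p : ℝ)⁻¹))⁻¹ *
        ∏ p ∈ (Nat.primesLE P).filter (fun p => Q < p), (1 - ((p : ℝ) ^ 2)⁻¹) <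
      rexp eulerMascheroniConstant * Real.log (θ P + (θ Q + ((lamQ (pieceK k P) : ℚ) : ℝ))) := by
    by_cases hfl : (4 : ℝ) ^ (k + 1) ≤ (X : ℝ)
    · -- full level: window top `4^{k+1}`
      have hlev := htol k _ hk11 hk17 (hfull k hk11 hk17 hfl)
      rw [← sqrt_four_pow (k + 1)] at hlev
      have hPu' : (P : ℝ) ≤ (4 : ℝ) ^ (k + 1) := by exact_mod_cast hPu.le
      have hW' : ∀ y : ℝ, 599 ≤ y → y ≤ (4 : ℝ) ^ (k + 1) → |θ y - y| ≤ √y * Real.log y ^ 2 / (8 * π) :=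
        fun y hy hyB => hWX y hy (hyB.trans hfl)
      exact mertensProdLt_stair_of hB hK hT hRH hk11 hk17 hPl hPu' hW'
        (fun b' hb' => hkey hW' hk11 hk17 hPl hPu.le hPu' hQP hQs hb') hlev
    · -- top level: window top `X`
      rw [not_le] at hfl
      exact mertensProdLt_stair_of hB hK hT hRH hk11 hk17 hPl hPX hWX
        (fun b' hb' => hkey hWX hk11 hk17 hPl hPu.le hPX hQP hQs hb') (htop k hk11 hk17 hkX hfl)
  have hNpos : (0 : ℝ) < N := by exact_mod_cast Nat.pos_of_ne_zero hN0
  have hθpos : 0 < θ P + (θ Q + ((lamQ (pieceK k P) : ℚ) : ℝ)) := by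
    have h1 : 0 < θ (P : ℝ) := Chebyshev.theta_pos (by exact_mod_cast hP.two_le)
    have h2' : 0 ≤ θ (Q : ℝ) := Chebyshev.theta_nonneg _
    obtain ⟨-, -, -, -, -, -, hΛ₁0, hΛ₂0, -⟩ := level_consts hk11 hk17
    have h3 : 0 ≤ ((lamQ (pieceK k P) : ℚ) : ℝ) := by unfold pieceK; split_ifs <;> assumption
    linarith
  have hlog : Real.log (θ P + (θ Q + ((lamQ (pieceK k P) : ℚ) : ℝ))) ≤ Real.log (Real.log N) :=
    Real.log_le_log hθpos (by linarith)
  have hlt' : (σ 1 N : ℝ) / N < rexp eulerMascheroniConstant * Real.log (Real.log N) :=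
    lt_of_le_of_lt hσ (hlt.trans_le (mul_le_mul_of_nonneg_left hlog (Real.exp_pos _).le))
  unfold robinInequality
  rw [div_lt_iff₀ hNpos] at hlt'
  linarith


open scoped ArithmeticFunction.sigma in
/-- **C6 · THE LOW-HEIGHT CA-SIDE HEIGHT LAW WITH THE WHOLE STAIRCASE.  RH verified to ANY height `T ≥ 10⁵` + {Büthe 2016
Thm 2, Büthe 2018 Thm 2, BKLNW 2021} ⟹ Robin's inequality at every colossally abundant `N > 5040` all of whose primes are
`≤ X`** (`X < 4¹⁸`), provided every FULL level `4ᵏ⁺¹ ≤ X` has `tailH(T) ≤ tolSt k` and the TOP level `4ᵏ ≤ X < 4ᵏ⁺¹` passes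
`0.0463 + (1 + 2/L1 k)·tailH(T)·(√X + 1/√X)/2 ≤ b_k + d_k` (tree `robinCA_below_low_refl`: budgets `b_k`, full levels only;
primes `< 4¹¹` by the kernel theorem `robinCA_below_four_pow_eleven`; the `θ`-window from Büthe 2016 + RH(T), `thetaWindow_of_top`).  New CA-side input: `log N ≥ θP + θQ + Λ_K` (the storeys
`≥ 3`, `theta_add_theta_add_lam_le_log`) and `Q < 4√P + 4` (`structureQ_lt`).  No conjecture in hypothesis position; nothing
here bears on the truth of RH. -/
theorem robinCA_below_stair (h16 : Buthe2016_thm2) (hB : Buthe2018_thm2_theta)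
    (hK : BroadbentEtAl2021_theta_rel_1e19) {T : ℝ} (hT : 100000 ≤ T) (hRH : RiemannHypothesisUpTo T) {X : ℕ}
    (hX18 : (X : ℝ) < (4 : ℝ) ^ 18)
    (hfull : ∀ k : ℕ, 11 ≤ k → k ≤ 17 → (4 : ℝ) ^ (k + 1) ≤ (X : ℝ) →
      ((Real.log (T / (2 * π)) + 1) / (π * T) + (184 + 30 * Real.log T) / T ^ 2) ≤ ((tolSt k : ℚ) : ℝ))
    (htop : ∀ k : ℕ, 11 ≤ k → k ≤ 17 → (4 : ℝ) ^ k ≤ (X : ℝ) → (X : ℝ) < (4 : ℝ) ^ (k + 1) →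
      0.0463 + (1 + 2 / ((L1 k : ℚ) : ℝ)) *
        (((Real.log (T / (2 * π)) + 1) / (π * T) + (184 + 30 * Real.log T) / T ^ 2) * ((√(X : ℝ) + (√(X : ℝ))⁻¹) / 2)) ≤
        ((bk k : ℚ) : ℝ) + ((dk k : ℚ) : ℝ)) :
    robinCA_below (X + 1) :=
  robinCA_below_stair_of (β := bk) (tol := tolSt)
    (fun hW _ hk11 hk17 _ _ hPl hPu hPB hQP hQs _ hb' => key_ineq_level3 hW hk11 hk17 hPl hPu hPB hQP hQs hb')
    (fun _ _ hk11 hk17 ht => level3_of_tolSt hk11 hk17 ht) hB hK hT hRH hX18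
    (thetaWindow_of_top h16 hT hRH (fun _ hk11 hk17 => bk_cap hk11 hk17) hX18 htop) hfull htop

end StaircaseLaw

end Summit.RiemannHypothesis.RiemannHypothesis.Theorems.Splittings.RobinFiniteC1

end
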